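import Mathlib
import Summits.ResolutionOfSingularities.ResolutionOfSingularities.Theorems.WeightedInvariantLocalWeightedDropNCResCurveGraphIdeal
import Summits.ResolutionOfSingularities.ResolutionOfSingularities.Theorems.WeightedInvariantLocalWeightedDropRestrictedChartTransport
import Summits.ResolutionOfSingularities.ResolutionOfSingularities.Theorems.WeightedInvariantLocalWeightedDropNCResSettingLetters

/-!
# `WeightedInvariant.LocalWeightedDrop`: NC-RESOLUTION SETTINGS for the TOT₂ line (S-SET) — GRAPH CURVES: the chart identity of the
# identity point move at a tangent answer (S-E1-CURVE (C2), (C3))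

Crux item stmt-ResolutionOfSingularities-8899 `LocalWeightedDrop` (route `ResolutionOfSingularities/WeightedInvariant`), ENGINE skeleton v32,
residual `stub_spaceNCRankDrop`; TOT2-LINE (res-L1-w43-lead-1) inner dispatch, sub-regime S-E1-CURVE of res-L1-w43-stub-1 (gap note
`L/res-L1-w43-stub-1/E1-CURVE-GAP.md`; definitions `GraphCurve.shear / step / InOffIdeal` of parts 14–15).  [OURS · L1 W4.3 · chain w43 · seat
res-type-056 for res-L1-w43-stub-1 (WANT 15:02:59Z); def-free; the count game is the programme's own; nothing here is a statement of any manuscript;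
AI-produced, gate-checked, weaker than expert review.]

WHAT.  The loop of S-E1-CURVE blows up the POINT (the identity move) and follows the curve `C = {x_j = φ_j(x_i)}` to its strict transform.  In
the restricted `x_i`-chart at an answer `c′` ON THE TANGENT LINE of `C` (`c′_j = c′_i · φ_j′(0)`), the strict transform of `C` is again a graph,
now over the NEW exceptional letter `s = x_0` of the successor: `y_{j′} = −stepSeries φ_j …`, with `GraphCurve.step i φ c′` the new datum
(part 14).  The algebraic content is ONE identity of substitutions (C2):

  `ρ_{c′_i e_i, i} ∘ shear_i(φ) = shear_0(step i φ c′) ∘ ρ_{c′, i}`   on `k⟦x_0,…,x_m⟧`,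

checked on generators — `x_i ↦ c′_i s` on both sides; `x_j ↦ s·y_{j′} + φ_j(c′_i s)` on both sides, because
`s · stepSeries φ_j (c′_i) (c′_j) = φ_j(c′_i s) − c′_j s` (`GraphCurve.X_mul_stepSeries`) — and its consequence (C3): if the `i`-axis is
permissible for `shear_i(φ)^* F` at order `c` (`InOffIdeal i c`), then the `s`-axis is permissible for `shear_0(step)^* (ρ_{c′,i}^* F)` at order `c`
(`InOffIdeal 0 c`), by (C2) and `InOffIdeal.subst` (every non-`i` component of the chart `ρ_{c′_i e_i, i}` is `s · y_{j′} ∈ (y)`).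
No determinant and no transport matrix is needed here (contrast `RestrictedChartTransport.exists_transport`, the general legal `θ`): the graph
shear is unipotent and the transported change of coordinates is EXPLICIT.
-/

set_option linter.dupNamespace false -- mandated namespace of this single-conjunct summit

noncomputable section

namespace Summit.ResolutionOfSingularities.ResolutionOfSingularities.Theorems

namespace TameFourTupleDrop

namespace GraphCurve

open MvPowerSeries Literature.AlgebraicGeometry.Resolution

variable {k : Type} [Field k] {m : ℕ}

/-! ## The restricted chart family and the step shear are substitutable -/

/-- The restricted chart family `ρ_{c,i} : x_l ↦ x_0 · (c_l + [l ≠ i] y_{l′})` has zero constant terms, hence may be substituted. -/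
theorem hasSubst_chart (c : Fin (m + 1) → k) (i : Fin (m + 1)) :
    HasSubst (fun l : Fin (m + 1) => X 0 * (C (c l) +
      if l = i then (0 : MvPowerSeries (Fin (m + 1)) k) else X (Fin.predAbove i l.succ))) :=
  hasSubst_of_constantCoeff_zero fun l => by rw [map_mul, constantCoeff_X, zero_mul]

/-- At a tangent answer (`c′_j = c′_i · φ_j′(0)` for `j ≠ i`) every non-exceptional component of the step datum has zero constant term. -/
theorem constantCoeff_step_of_ne_zero (i : Fin (m + 1)) (φ : Fin (m + 1) → PowerSeries k) {c' : Fin (m + 1) → k}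
    (hc' : ∀ j, j ≠ i → c' j = c' i * PowerSeries.coeff 1 (φ j)) {q : Fin (m + 1)} (hq : q ≠ 0) :
    PowerSeries.constantCoeff (step i φ c' q) = 0 := by
  obtain ⟨p, rfl⟩ := Fin.exists_succ_eq.mpr hq
  rw [step_succ]
  exact constantCoeff_stepSeries (hc' _ (Fin.succAbove_ne i p))

/-- Hence the step shear `shear 0 (step i φ c′)` may be substituted. -/
theorem hasSubst_shear_step (i : Fin (m + 1)) (φ : Fin (m + 1) → PowerSeries k) {c' : Fin (m + 1) → k}
    (hc' : ∀ j, j ≠ i → c' j = c' i * PowerSeries.coeff 1 (φ j)) : HasSubst (shear 0 (step i φ c')) :=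
  hasSubst_shear fun _ hq => constantCoeff_step_of_ne_zero i φ hc' hq

/-- The scaled tangent `c′ = λ · tangent` is a tangent answer: `c′_j = c′_i · φ_j′(0)` for `j ≠ i`. -/
theorem smul_tangent_of_ne (i : Fin (m + 1)) (φ : Fin (m + 1) → PowerSeries k) (lam : k) (j : Fin (m + 1)) (hj : j ≠ i) :
    (lam • tangent i φ) j = (lam • tangent i φ) i * PowerSeries.coeff 1 (φ j) := by
  rw [Pi.smul_apply, Pi.smul_apply, tangent_self, tangent_of_ne hj, smul_eq_mul, smul_eq_mul, mul_one]

/-! ## One-variable series along the exceptional letter -/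

/-- `X 0` may be substituted into one-variable series. -/
theorem hasSubst_X_zero : PowerSeries.HasSubst (X 0 : MvPowerSeries (Fin (m + 1)) k) :=
  PowerSeries.HasSubst.of_constantCoeff_zero (constantCoeff_X 0)

/-- `φ(λ s)` two ways: rescale then place on the letter `s = x_0`, or substitute `λ · x_0`. -/
theorem onLetter_zero_rescale (lam : k) (φ : PowerSeries k) :
    onLetter (0 : Fin (m + 1)) (PowerSeries.rescale lam φ) = PowerSeries.subst (lam • (X 0 : MvPowerSeries (Fin (m + 1)) k)) φ := by
  rw [onLetter, PowerSeries.rescale_eq_subst, PowerSeries.subst_comp_subst_apply (PowerSeries.HasSubst.smul_X' lam) hasSubst_X_zero,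
    PowerSeries.subst_smul hasSubst_X_zero, PowerSeries.subst_X hasSubst_X_zero]

/-- THE STEP IDENTITY ON THE LETTER `s`: `s · (stepSeries φ λ a)(s) = φ(λ s) − a s`. -/
theorem X_zero_mul_onLetter_stepSeries {φ : PowerSeries k} (h0 : PowerSeries.constantCoeff φ = 0) (lam a : k) :
    (X 0 : MvPowerSeries (Fin (m + 1)) k) * onLetter 0 (stepSeries φ lam a) =
      PowerSeries.subst (lam • (X 0 : MvPowerSeries (Fin (m + 1)) k)) φ - C a * X 0 := by
  have h := congrArg (onLetter (0 : Fin (m + 1)) (k := k)) (X_mul_stepSeries h0 lam a)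
  rw [onLetter, PowerSeries.subst_mul hasSubst_X_zero, PowerSeries.subst_X hasSubst_X_zero, onLetter, PowerSeries.subst_sub hasSubst_X_zero,
    PowerSeries.subst_mul hasSubst_X_zero, PowerSeries.subst_C, PowerSeries.subst_X hasSubst_X_zero] at h
  rw [onLetter, h, ← onLetter, onLetter_zero_rescale]

/-! ## (C2) The chart identity -/

/-- **(C2) THE CHART IDENTITY OF THE IDENTITY POINT MOVE AT A TANGENT ANSWER.**  For the graph shear `shear i φ` (`φ_j(0) = 0`), an answer
`c′` on the tangent line (`c′_j = c′_i · φ_j′(0)`, `j ≠ i`) and any germ `F`: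
`ρ_{c′_i e_i, i}^* (shear_i(φ)^* F) = shear_0(step i φ c′)^* (ρ_{c′, i}^* F)` — reading `shear_i(φ)^* F` in the restricted `x_i`-chart at the
AXIS POINT `c′_i e_i` is the same as reading `F` in the restricted `x_i`-chart at `c′` and then applying the graph shear of the NEW datum
`step i φ c′` over the exceptional letter `0`.  On generators: `x_i ↦ c′_i s` on both sides; for `j = i.succAbove p` (new letter `j′ = p.succ`)
`x_j ↦ s · y_{j′} + φ_j(c′_i s)` on both sides (`X_zero_mul_onLetter_stepSeries`). -/
theorem subst_chart_shear (i : Fin (m + 1)) (φ : Fin (m + 1) → PowerSeries k)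
    (hφ : ∀ j, j ≠ i → PowerSeries.constantCoeff (φ j) = 0) (c' : Fin (m + 1) → k)
    (hc' : ∀ j, j ≠ i → c' j = c' i * PowerSeries.coeff 1 (φ j)) (F : MvPowerSeries (Fin (m + 1)) k) :
    subst (fun l => X 0 * (C (if l = i then c' i else 0) +
        if l = i then (0 : MvPowerSeries (Fin (m + 1)) k) else X (Fin.predAbove i l.succ))) (subst (shear i φ) F) =
      subst (shear 0 (step i φ c')) (subst (fun l => X 0 * (C (c' l) +
        if l = i then (0 : MvPowerSeries (Fin (m + 1)) k) else X (Fin.predAbove i l.succ))) F) := by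
  have hρ0 : HasSubst (fun l : Fin (m + 1) => X 0 * (C (if l = i then c' i else 0) +
      if l = i then (0 : MvPowerSeries (Fin (m + 1)) k) else X (Fin.predAbove i l.succ))) :=
    hasSubst_chart (fun l => if l = i then c' i else 0) i
  have hρ : HasSubst (fun l : Fin (m + 1) => X 0 * (C (c' l) +
      if l = i then (0 : MvPowerSeries (Fin (m + 1)) k) else X (Fin.predAbove i l.succ))) := hasSubst_chart c' i
  have hS : HasSubst (shear 0 (step i φ c')) := hasSubst_shear_step i φ hc'
  rw [subst_comp_subst_apply (hasSubst_shear hφ) hρ0, subst_comp_subst_apply hρ hS]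
  have hfam : (fun l => subst (fun l : Fin (m + 1) => X 0 * (C (if l = i then c' i else 0) +
      if l = i then (0 : MvPowerSeries (Fin (m + 1)) k) else X (Fin.predAbove i l.succ))) (shear i φ l)) =
      (fun l => subst (shear 0 (step i φ c')) (X 0 * (C (c' l) +
        if l = i then (0 : MvPowerSeries (Fin (m + 1)) k) else X (Fin.predAbove i l.succ)))) := by
    funext l
    rcases Fin.eq_self_or_eq_succAbove i l with rfl | ⟨p, rfl⟩
    · -- the graph letter: `x_i ↦ c′_i s` on both sides
      rw [shear_self, subst_X hρ0]
      simp only [if_true, add_zero]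
      rw [subst_mul hS, subst_X hS, shear_self, subst_C]
    · -- a graph coordinate `x_j`, `j = i.succAbove p`, new letter `p.succ`
      have hj : i.succAbove p ≠ i := Fin.succAbove_ne i p
      have key := X_zero_mul_onLetter_stepSeries (m := m) (hφ _ hj) (c' i) (c' (i.succAbove p))
      rw [shear_of_ne hj, subst_add hρ0, subst_X hρ0, subst_onLetter _ hρ0]
      simp only [if_neg hj, if_true, RestrictedChartTransport.predAbove_succAbove_succ]
      rw [subst_mul hS, subst_X hS, shear_self, subst_add hS, subst_C, subst_X hS, shear_of_ne (Fin.succ_ne_zero p), step_succ,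
        map_zero, zero_add, add_zero, mul_comm (X 0) (C (c' i)), ← MvPowerSeries.smul_eq_C_mul, mul_add, mul_add, key]
      ring
  rw [hfam]

/-- (C2) at the scaled tangent `c′ = λ · tangent i φ` (the form in which the near-answer analysis delivers the answer). -/
theorem subst_chart_shear_smul_tangent (i : Fin (m + 1)) (φ : Fin (m + 1) → PowerSeries k)
    (hφ : ∀ j, j ≠ i → PowerSeries.constantCoeff (φ j) = 0) (lam : k) (F : MvPowerSeries (Fin (m + 1)) k) :
    subst (fun l => X 0 * (C (if l = i then (lam • tangent i φ) i else 0) +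
        if l = i then (0 : MvPowerSeries (Fin (m + 1)) k) else X (Fin.predAbove i l.succ))) (subst (shear i φ) F) =
      subst (shear 0 (step i φ (lam • tangent i φ))) (subst (fun l => X 0 * (C ((lam • tangent i φ) l) +
        if l = i then (0 : MvPowerSeries (Fin (m + 1)) k) else X (Fin.predAbove i l.succ))) F) :=
  subst_chart_shear i φ hφ (lam • tangent i φ) (smul_tangent_of_ne i φ lam) F

/-! ## (C3) Permissibility of the new axis -/

/-- Every non-`i` component of the axis-point chart `ρ_{c′_i e_i, i}` lies in the ideal of the new non-exceptional letters:
`x_j ↦ s · y_{j′}` with `j′ ≠ 0`. -/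
theorem inOffIdeal_chart_axisPoint_of_ne (i : Fin (m + 1)) (a : k) {j : Fin (m + 1)} (hj : j ≠ i) :
    InOffIdeal 0 1 (X 0 * (C (if j = i then a else 0) +
      if j = i then (0 : MvPowerSeries (Fin (m + 1)) k) else X (Fin.predAbove i j.succ))) := by
  simp only [if_neg hj, map_zero, zero_add]
  exact (inOffIdeal_X_of_ne (TameFourTupleDrop.predAbove_succ_ne_zero hj)).mul_left (X 0)

/-- **(C3) THE NEW AXIS IS PERMISSIBLE.**  If the `i`-axis is permissible at order `c` for `shear_i(φ)^* F` (the curve `C` is permissible for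
`F`), then at a tangent answer `c′` the `s`-axis is permissible at order `c` for `shear_0(step i φ c′)^* (ρ_{c′,i}^* F)` (the strict transform of
`C` is permissible for the transform of `F`): (C2) and `InOffIdeal.subst` along the axis-point chart. -/
theorem inOffIdeal_chart_step {i : Fin (m + 1)} {φ : Fin (m + 1) → PowerSeries k} {c : ℕ} {c' : Fin (m + 1) → k}
    {F : MvPowerSeries (Fin (m + 1)) k} (hperm : InOffIdeal i c (subst (shear i φ) F))
    (hφ : ∀ j, j ≠ i → PowerSeries.constantCoeff (φ j) = 0) (hc' : ∀ j, j ≠ i → c' j = c' i * PowerSeries.coeff 1 (φ j)) :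
    InOffIdeal 0 c (subst (shear 0 (step i φ c')) (subst (fun l => X 0 * (C (c' l) +
      if l = i then (0 : MvPowerSeries (Fin (m + 1)) k) else X (Fin.predAbove i l.succ))) F)) := by
  rw [← subst_chart_shear i φ hφ c' hc' F]
  exact hperm.subst _ (hasSubst_chart _ i) fun j hj => inOffIdeal_chart_axisPoint_of_ne i (c' i) hj

end GraphCurve

end TameFourTupleDrop

end Summit.ResolutionOfSingularities.ResolutionOfSingularities.Theorems

end
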